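import Literature.Probability.RandomPlanarGeometry.HexSAWPolygonStepTwo
import Literature.Probability.RandomPlanarGeometry.HexSAWPolygonStepSix
import Literature.Probability.RandomPlanarGeometry.HexSAWPolygonCensus
import HarnessLib

/-!
# XLV — the honeycomb polygon numbers are monotone along the even lengths from `N = 12` on; the step two holds exactly off `N = 6, 10`

Topic `Literature/Probability/RandomPlanarGeometry` (lane «pcv-sawmu», a-p4 g23; corollaries of XLIV `HexSAWPolygonStepTwo`
(`HexCell.hexPolygonNumber_le_add_two`: `q_N ≤ q_{N+2}`, even `N ≥ 12`) with the tree's `hexPolygonNumber_mono_of_even_sub` (`HexSAWPolygonStepSix`: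
steps `≥ 4`) and the kernel-checked census `hexPolygonNumber_six/eight/ten/twelve` (`HexSAWPolygonCensus`)).

* ★★ `hexPolygonNumber_mono` — for even `12 ≤ N ≤ N'` (both even), `hexPolygonNumber N ≤ hexPolygonNumber N'`: the sequence
  `q_12, q_14, q_16, …` of honeycomb polygon numbers is non-decreasing (Madras–Slade (3.2.3) on `ℤ^d` gives every step; on `ℍ` the step `2` needed
  the lane's injection OMEGA, XVII–XLIV).
* ★★ `hexPolygonNumber_le_add_two_iff` — for even `N ≥ 6`: `q_N(ℍ) ≤ q_{N+2}(ℍ) ↔ N ≠ 6 ∧ N ≠ 10` (the two failures are `q_6 = 1 > 0 = q_8` and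
  `q_10 = 3 > 2 = q_12`).

Sources: N. Madras, G. Slade, *The Self-Avoiding Walk* (1993), §3.2, Theorem 3.2.3 (3.2.3) p. 64 [MadrasSlade1993]; I. Jensen, J. Phys.: Conf. Ser. 42
(2006) 163, §2; A. J. Guttmann, I. Jensen, in *Polygons, Polyominoes and Polycubes* (2009), Table 16.3 (`p_6 = 1, p_8 = 0, p_10 = 3, p_12 = 2`)
[GuttmannJensen2009SeriesData].  Label (lane): LANE THEOREM (corollary form of the settled step two); the `ℍ` statements are the lane's, not the sources'.
-/

namespace Literature.Probability.RandomPlanarGeometry.SAW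

namespace HexCell

open HexBW

/-- ★★ **Monotonicity of the honeycomb polygon numbers along the even lengths from `12` on**: `q_N(ℍ) ≤ q_{N'}(ℍ)` for even `N, N'` with
`12 ≤ N ≤ N'`. [cite: MadrasSlade1993, §3.2, Theorem 3.2.3 (3.2.3) p. 64 (`ℤ^d`; transplanted to `ℍ` — lane result)] -/
theorem hexPolygonNumber_mono {N N' : ℕ} (hN : 12 ≤ N) (hNN' : N ≤ N') (hE : Even N) (hE' : Even N') :
    hexPolygonNumber N ≤ hexPolygonNumber N' := by
  have he : Even (N' - N) := by
    obtain ⟨a, rfl⟩ := hE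
    obtain ⟨b, rfl⟩ := hE'
    exact ⟨b - a, by omega⟩
  rcases Nat.lt_or_ge N' (N + 4) with hlt | hge
  · -- `N' = N` or `N' = N + 2`
    obtain ⟨c, hc⟩ := he
    rcases Nat.lt_or_ge c 1 with hc0 | hc1
    · have : N' = N := by omega
      rw [this]
    · have : N' = N + 2 := by omega
      rw [this]
      exact hexPolygonNumber_le_add_two hN hE
  · exact hexPolygonNumber_mono_of_even_sub (by omega) hge he

/-- ★★ **The step two on the honeycomb lattice holds exactly off `N = 6` and `N = 10`**: for even `N ≥ 6`,
`hexPolygonNumber N ≤ hexPolygonNumber (N + 2) ↔ N ≠ 6 ∧ N ≠ 10` (`q_6 = 1 > q_8 = 0`, `q_8 = 0 ≤ q_10 = 3`, `q_10 = 3 > q_12 = 2`, and the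
step two from `12` on). [cite: MadrasSlade1993, §3.2, Theorem 3.2.3 (3.2.3) p. 64 (`ℤ^d`; the `ℍ` form is the lane's)]
[cite: GuttmannJensen2009SeriesData, Table 16.3 (p_6 = 1, p_8 = 0, p_10 = 3, p_12 = 2)] -/
theorem hexPolygonNumber_le_add_two_iff {N : ℕ} (hN : 6 ≤ N) (hE : Even N) :
    hexPolygonNumber N ≤ hexPolygonNumber (N + 2) ↔ N ≠ 6 ∧ N ≠ 10 := by
  constructor
  · intro h
    refine ⟨fun e => ?_, fun e => ?_⟩
    · subst e
      rw [hexPolygonNumber_six, hexPolygonNumber_eight] at h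
      omega
    · subst e
      rw [hexPolygonNumber_ten, hexPolygonNumber_twelve] at h
      omega
  · rintro ⟨h6, h10⟩
    rcases Nat.lt_or_ge N 12 with hlt | hge
    · -- the only even `N` in `[6, 12)` other than `6, 10` is `8`
      obtain ⟨a, rfl⟩ := hE
      have : a = 4 := by omega
      subst this
      show hexPolygonNumber 8 ≤ hexPolygonNumber 10
      rw [hexPolygonNumber_eight, hexPolygonNumber_ten]
      omega
    · exact hexPolygonNumber_le_add_two hge hE

end HexCell

end Literature.Probability.RandomPlanarGeometry.SAW
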